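import Literature.Algebra.EuclideanLattices.RegevSmoothingLowerBound
import Literature.Algebra.EuclideanLattices.PQCLLLProofs
import HarnessLib

/-!
# Regev 2009, Lemma 3.17: the radius search (`φ(L) < rᵢ ≤ 2φ(L)` for some `i ≤ 2n`)

Topic `Algebra/EuclideanLattices` (family `pqc`). Serves the decomposition of the named fact
`Literature.Computability.Cryptography.regev_lwe_to_sivp_quantum` (pqc.S19; Regev, J. ACM 56 (2009),
Thm 1.1), step `GIVP_{2√n φ} ≤ DGS_φ` (**Lemma 3.17**, hypothesis `h₃` of
`regev_lwe_to_sivp_quantum_of_worstCase`). The reduction does not know `φ(L)`; it computes an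
LLL-reduced basis, lets `λ̃ₙ` be the length of its longest vector, and calls the `DGS` oracle with
the radii `rᵢ = λ̃ₙ 2^{-i}`, `i = 0, …, 2n`. Its correctness rests on the deterministic dichotomy
proved here (Regev 2009, p. 21): *"If `φ(L) ≥ λ̃ₙ` then `S` is already shorter than `2√n φ(L)` and
so we are done. Otherwise, let `i ∈ {0,…,2n}` be such that `φ(L) < rᵢ ≤ 2φ(L)`. Such an `i` must
exist by Claim 2.13"* — together with LLL82 Prop. 1.12 (`λ̃ₙ ≤ 2^{(n-1)/2} λₙ(L)`, the tree theorem
`IsLLLReduced.norm_sq_le_two_pow_mul_successiveMinimum_sq_holds`) and Claim 2.13 in the form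
`λₙ(L) ≤ (5/4) n η_ε(L)` (`Regev2009.successiveMinimum_le_mul_smoothingParameter`,
`RegevSmoothingLowerBound.lean`).

Everything here is PROVED; theorems only, no named facts. The statements allow the machine to use
any radius scale `R` with `λ̃ₙ ≤ R ≤ 2 λ̃ₙ` (e.g. a power of two, so that all `rᵢ = R 2^{-i}` are
exact rationals), which only shifts the printed count `2n + 1` of radii by one (`i ≤ 2n + 1`); with
`R = λ̃ₙ` exactly one recovers `i ≤ 2n`.

## Main results

* `Regev2009.exists_radius_le_two_mul` — real arithmetic: `φ < R ≤ 2^{K+1} φ` gives `i ≤ K` with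
  `φ < R/2ⁱ ≤ 2φ`.
* `Regev2009.norm_le_two_pow_mul_successiveMinimum_of_isLLLReduced` — LLL82 Prop. 1.12 in the form
  `‖bⱼ‖ ≤ 2ⁿ λₙ(L)`.
* `Regev2009.norm_le_four_pow_mul_of_isLLLReduced` — with Claim 2.13: `‖bⱼ‖ ≤ 4ⁿ φ` whenever
  `√2 η_ε(L) ≤ φ`, `0 < ε ≤ 1/10`.
* `Regev2009.lll_short_or_exists_radius` — **the dichotomy of the proof of Lemma 3.17**: either
  every vector of the LLL-reduced basis has norm `≤ φ` (so the basis solves `GIVP_{2√n φ}`), or some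
  radius `R/2ⁱ`, `i ≤ 2n + 1`, lies in `(φ, 2φ]`.

## References

* O. Regev, *On lattices, learning with errors, random linear codes, and cryptography*, J. ACM 56
  (2009), art. 34 (author's version arXiv:2401.03703), Lemma 3.17 (proof, p. 21), Claim 2.13
  [Regev2009].
* A. K. Lenstra, H. W. Lenstra, L. Lovász, *Factoring polynomials with rational coefficients*,
  Math. Ann. 261 (1982), Prop. 1.12 [LenstraLenstraLovasz1982].
-/

noncomputable section

open Module

namespace Literature.Algebra.EuclideanLattices

namespace Regev2009

/-! ### Real arithmetic of the radius search -/

/-- **Halving down into `(φ, 2φ]`**: if `φ < R` and `R ≤ 2^{K+1} φ` then some `rᵢ = R/2ⁱ` with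
`i ≤ K` satisfies `φ < rᵢ ≤ 2φ` (take the least `i` with `R/2ⁱ ≤ 2φ`). [cite: Regev2009, Lemma 3.17 (proof)] -/
theorem exists_radius_le_two_mul {φ R : ℝ} (hφR : φ < R) {K : ℕ}
    (hRK : R ≤ 2 ^ (K + 1) * φ) :
    ∃ i : ℕ, i ≤ K ∧ φ < R / 2 ^ i ∧ R / 2 ^ i ≤ 2 * φ := by
  classical
  have hex : ∃ i : ℕ, R / 2 ^ i ≤ 2 * φ :=
    ⟨K, by rw [div_le_iff₀ (by positivity), pow_succ] at *; linarith⟩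
  refine ⟨Nat.find hex, ?_, ?_, Nat.find_spec hex⟩
  · exact Nat.find_min' hex (show R / 2 ^ K ≤ 2 * φ by
      rw [div_le_iff₀ (by positivity)]; rw [pow_succ] at hRK; linarith)
  · rcases Nat.eq_zero_or_pos (Nat.find hex) with h0 | hpos
    · rw [h0, pow_zero, div_one]; exact hφR
    · -- minimality at `i - 1`: `R/2^{i-1} > 2φ`, i.e. `R/2^i > φ`
      have hmin := Nat.find_min hex (Nat.sub_one_lt_of_lt hpos)
      rw [not_le] at hmin
      have hi : Nat.find hex = (Nat.find hex - 1) + 1 := (Nat.sub_add_cancel hpos).symm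
      rw [hi, pow_succ, ← div_div, lt_div_iff₀ two_pos]
      linarith

/-! ### The LLL length bound -/

section LLL

variable {E : Type*} [NormedAddCommGroup E] [InnerProductSpace ℝ E] {n : ℕ}

/-- **LLL82 Prop. 1.12, coarse form**: every vector of an LLL-reduced (`δ = 3/4`) basis of `E` has
norm at most `2ⁿ λₙ(L)`, `L = ∑ ℤ bₖ` (from `‖bⱼ‖² ≤ 2^{n-1} λₙ(L)²`). [cite: LenstraLenstraLovasz1982, Prop. 1.12] -/
theorem norm_le_two_pow_mul_successiveMinimum_of_isLLLReduced (b : Basis (Fin n) ℝ E)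
    (h : IsLLLReduced (3 / 4) ⇑b) (j : Fin n) :
    ‖b j‖ ≤ 2 ^ n * successiveMinimum (Literature.Computability.Cryptography.latticeOfBasis b) n := by
  have hn : 0 < n := Fin.pos j
  set L := Literature.Computability.Cryptography.latticeOfBasis b
  have h12 := IsLLLReduced.norm_sq_le_two_pow_mul_successiveMinimum_sq_holds b h ⟨n - 1, by omega⟩ j
    (by change (j : ℕ) ≤ n - 1; omega)
  have hidx : ((⟨n - 1, by omega⟩ : Fin n) : ℕ) + 1 = n := by change n - 1 + 1 = n; omega
  rw [hidx] at h12
  have hlam : 0 ≤ successiveMinimum L n := successiveMinimum_nonneg _ _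
  have hpow : (2 : ℝ) ^ (n - 1) ≤ (2 ^ n) ^ 2 := by
    rw [← pow_mul]
    exact pow_le_pow_right₀ one_le_two (by omega)
  have hsq : ‖b j‖ ^ 2 ≤ (2 ^ n * successiveMinimum L n) ^ 2 := by
    rw [mul_pow]
    exact h12.trans (mul_le_mul_of_nonneg_right hpow (sq_nonneg _))
  exact (pow_le_pow_iff_left₀ (norm_nonneg _) (by positivity) two_ne_zero).1 hsq

/-- **`λ̃ₙ ≤ 4ⁿ φ(L)`**: for an LLL-reduced basis of `L` (dimension `n ≥ 1`), `0 < ε ≤ 1/10` and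
`√2 η_ε(L) ≤ φ`, every basis vector has norm `≤ 4ⁿ φ` — LLL82 Prop. 1.12 (`≤ 2ⁿ λₙ`) with Claim 2.13
(`λₙ ≤ (5/4) n η_ε ≤ n φ`) and `n ≤ 2ⁿ`; this is the estimate behind "such an `i` must exist".
[cite: Regev2009, Lemma 3.17 (proof) with Claim 2.13] -/
theorem norm_le_four_pow_mul_of_isLLLReduced (b : Basis (Fin n) ℝ E) (h : IsLLLReduced (3 / 4) ⇑b)
    {ε φ : ℝ} (hε : 0 < ε) (hε10 : ε ≤ 1 / 10)
    (hφ : Real.sqrt 2 * smoothingParameter (Literature.Computability.Cryptography.latticeOfBasis b) ε ≤ φ)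
    (j : Fin n) : ‖b j‖ ≤ 4 ^ n * φ := by
  haveI : FiniteDimensional ℝ E := Module.Finite.of_basis b
  have hn : 0 < n := Fin.pos j
  haveI : Nontrivial E := Module.nontrivial_of_finrank_pos (R := ℝ)
    (by rw [finrank_eq_card_basis b, Fintype.card_fin]; exact hn)
  set L := Literature.Computability.Cryptography.latticeOfBasis b
  have hfin : finrank ℝ E = n := by rw [finrank_eq_card_basis b, Fintype.card_fin]
  have hη : 0 ≤ smoothingParameter L ε := smoothingParameter_nonneg _ _
  -- Claim 2.13: `λₙ(L) ≤ (5/4) n η_ε(L) ≤ n φ`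
  have hlam : successiveMinimum L n ≤ n * φ := by
    have h1 := successiveMinimum_le_mul_smoothingParameter L hε hε10
    rw [hfin] at h1
    have hsqrt : (5 / 4 : ℝ) ≤ Real.sqrt 2 := by
      rw [Real.le_sqrt (by norm_num) (by norm_num)]; norm_num
    have h2 : 5 / 4 * smoothingParameter L ε ≤ φ :=
      (mul_le_mul_of_nonneg_right hsqrt hη).trans hφ
    calc successiveMinimum L n ≤ 5 / 4 * n * smoothingParameter L ε := h1
      _ = n * (5 / 4 * smoothingParameter L ε) := by ring
      _ ≤ n * φ := mul_le_mul_of_nonneg_left h2 (Nat.cast_nonneg _)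
  have hφ0 : 0 ≤ φ := le_trans (by positivity) hφ
  have hn2 : (n : ℝ) ≤ 2 ^ n := by exact_mod_cast (Nat.lt_two_pow_self).le
  calc ‖b j‖ ≤ 2 ^ n * successiveMinimum L n := norm_le_two_pow_mul_successiveMinimum_of_isLLLReduced b h j
    _ ≤ 2 ^ n * (n * φ) := mul_le_mul_of_nonneg_left hlam (by positivity)
    _ ≤ 2 ^ n * (2 ^ n * φ) := mul_le_mul_of_nonneg_left (mul_le_mul_of_nonneg_right hn2 hφ0) (by positivity)
    _ = 4 ^ n * φ := by rw [← mul_assoc, ← mul_pow]; norm_num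

/-- **The dichotomy of the proof of Regev 2009, Lemma 3.17.** Let `b` be an LLL-reduced basis of
the lattice `L` (dimension `n ≥ 1`), `0 < ε ≤ 1/10`, `√2 η_ε(L) ≤ φ`, and let `R` be any radius
scale with `‖bⱼ‖ ≤ R` for all `j` and `R ≤ 2 ‖b_{j₀}‖` for some `j₀` (the printed choice is
`R = λ̃ₙ = maxⱼ ‖bⱼ‖`; a power of two in `[λ̃ₙ, 2λ̃ₙ]` is what a machine uses). Then EITHER all `bⱼ`
have norm `≤ φ` — the LLL basis itself consists of `n` linearly independent lattice vectors shorter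
than `2√n φ`, "and so we are done" — OR some radius `rᵢ = R/2ⁱ` with `i ≤ 2n + 1` satisfies
`φ < rᵢ ≤ 2φ` ("such an `i` must exist by Claim 2.13"; with `R = λ̃ₙ` the bound is `i ≤ 2n`).
[cite: Regev2009, Lemma 3.17 (proof)] -/
theorem lll_short_or_exists_radius (b : Basis (Fin n) ℝ E) (h : IsLLLReduced (3 / 4) ⇑b)
    {ε φ : ℝ} (hε : 0 < ε) (hε10 : ε ≤ 1 / 10)
    (hφ : Real.sqrt 2 * smoothingParameter (Literature.Computability.Cryptography.latticeOfBasis b) ε ≤ φ)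
    {R : ℝ} (hbR : ∀ j, ‖b j‖ ≤ R) {j₀ : Fin n} (hR : R ≤ 2 * ‖b j₀‖) :
    (∀ j, ‖b j‖ ≤ φ) ∨ ∃ i : ℕ, i ≤ 2 * n + 1 ∧ φ < R / 2 ^ i ∧ R / 2 ^ i ≤ 2 * φ := by
  haveI : FiniteDimensional ℝ E := Module.Finite.of_basis b
  have hn : 0 < n := Fin.pos j₀
  haveI : Nontrivial E := Module.nontrivial_of_finrank_pos (R := ℝ)
    (by rw [finrank_eq_card_basis b, Fintype.card_fin]; exact hn)
  by_cases hφR : φ < R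
  · right
    have hφ0 : 0 < φ := lt_of_lt_of_le (by
      have := smoothingParameter_pos_holds (Literature.Computability.Cryptography.latticeOfBasis b) hε
      positivity) hφ
    refine exists_radius_le_two_mul hφR (K := 2 * n + 1) ?_
    have h4 := norm_le_four_pow_mul_of_isLLLReduced b h hε hε10 hφ j₀
    calc R ≤ 2 * ‖b j₀‖ := hR
      _ ≤ 2 * (4 ^ n * φ) := by linarith
      _ = 2 ^ (2 * n + 1) * φ := by rw [pow_succ, pow_mul]; norm_num; ring
      _ ≤ 2 ^ (2 * n + 1 + 1) * φ := by
          refine mul_le_mul_of_nonneg_right (pow_le_pow_right₀ one_le_two (by omega)) hφ0.le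
  · left
    exact fun j => (hbR j).trans (not_lt.1 hφR)

/-- With the printed scale `R = λ̃ₙ = ‖b_{j₀}‖` for a longest basis vector `b_{j₀}`, the radius
index obeys the printed bound `i ≤ 2n`. [cite: Regev2009, Lemma 3.17 (proof)] -/
theorem lll_short_or_exists_radius_max (b : Basis (Fin n) ℝ E) (h : IsLLLReduced (3 / 4) ⇑b)
    {ε φ : ℝ} (hε : 0 < ε) (hε10 : ε ≤ 1 / 10)
    (hφ : Real.sqrt 2 * smoothingParameter (Literature.Computability.Cryptography.latticeOfBasis b) ε ≤ φ)
    {j₀ : Fin n} (hmax : ∀ j, ‖b j‖ ≤ ‖b j₀‖) :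
    (∀ j, ‖b j‖ ≤ φ) ∨
      ∃ i : ℕ, i ≤ 2 * n ∧ φ < ‖b j₀‖ / 2 ^ i ∧ ‖b j₀‖ / 2 ^ i ≤ 2 * φ := by
  haveI : FiniteDimensional ℝ E := Module.Finite.of_basis b
  have hn : 0 < n := Fin.pos j₀
  haveI : Nontrivial E := Module.nontrivial_of_finrank_pos (R := ℝ)
    (by rw [finrank_eq_card_basis b, Fintype.card_fin]; exact hn)
  by_cases hφR : φ < ‖b j₀‖
  · right
    have hφ0 : 0 < φ := lt_of_lt_of_le (by
      have := smoothingParameter_pos_holds (Literature.Computability.Cryptography.latticeOfBasis b) hε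
      positivity) hφ
    refine exists_radius_le_two_mul hφR (K := 2 * n) ?_
    have h4 := norm_le_four_pow_mul_of_isLLLReduced b h hε hε10 hφ j₀
    calc ‖b j₀‖ ≤ 4 ^ n * φ := h4
      _ = 2 ^ (2 * n) * φ := by rw [pow_mul]; norm_num
      _ ≤ 2 ^ (2 * n + 1) * φ :=
          mul_le_mul_of_nonneg_right (pow_le_pow_right₀ one_le_two (by omega)) hφ0.le
  · left
    exact fun j => (hmax j).trans (not_lt.1 hφR)

end LLL

end Regev2009

end Literature.Algebra.EuclideanLattices

end
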